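import Summits.Ventures.PercRepro.C041ConeClass
import Summits.Ventures.PercRepro.C041ZoneEmb

/-!
# ROW C-041 — THE ONE-MARKED-VERTEX SEED IN CONE FORM: the six-vector of every zone whose marks sit at one vertex
lies in the cone (p6, gen 30; mine-3's THEOREM (ONE MARKED VERTEX), C-041.md §19 (j), strengthened from (P) to
cone membership)

A zone `Z` (ANY multigraph, cycles allowed) with all its `1`- and `2`-marks at ONE vertex `v₀` and any anchor `k` EMBEDS
(`C041ZoneEmb`) into the pendant attachment (`C041PendantZone`) of the marked point `pointZone p q`
(`C041PointZone`; `p = #T₁`, `q = #T₂`) at `v₀` on the unmarked multigraph `Z` itself: the vertices go to the left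
summand, the edges to the left summand, the marks to the point's marks, which the pendant redirects to `v₀`; the
only vertex left over is the pendant's stray copy of the point (`oneVertexEmb`).  The pendant is a member of the
class 𝒵 (`IsZc.pendant` on the seed `IsZc.point`, `C041ConeClass`), so its six-vector lies in the cone
(`IsZc.inCone`), and STRAY-VERTEX INVARIANCE (`ZoneEmb.sixVec_eq`) carries this back to `Z`:

* **`inCone_sixVec_oneVertex`** — `InCone (Z.sixVec k)` for every zone with its marks at one vertex;
* `IsZc.inCone_of_emb` / `IsZc.zoneCSConj_of_emb` / `IsZc.zoneOCubeConj_of_emb` — every zone embedded in a member of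
  𝒵 (its stray vertices removed) has its six-vector in the cone, hence (CS) and the ZONE O-CUBE;
* `oneVertex_K4`, `oneVertex_zoneCSConj'`, `oneVertex_zoneOCubeConj'` — (P), the one-anchor (CS) and the ZONE O-CUBE
  on one-vertex zones re-derived from the cone (mine-3's `oneVertex_cs` / `oneVertex_zoneOCubeConj` from the
  fibre count, `C041ZoneOneVertexMain`, are the independent first proofs);
* `inCone_sixVec_pendant_oneVertex` — a one-vertex zone hung at any vertex of any unmarked multigraph: cone
  membership propagates, so one-vertex zones are SEEDS of the six-vector form of 𝒵 (`C041PendantCone`).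
-/

namespace PercRepro

namespace ZoneZ

open ZoneData TreeClosure Pendant PointZone Finset

/-! ## Members of 𝒵 with their stray vertices removed -/

namespace IsZc

variable {V E T₁ T₂ : Type*} {V' E' T₁' T₂' : Type} {Z : ZoneData V E T₁ T₂} {Z' : ZoneData V' E' T₁' T₂'}
  [Fintype E] [DecidableEq E] [Fintype T₁] [DecidableEq T₁] [Fintype T₂] [DecidableEq T₂]

/-- **Every zone embedded in a member of 𝒵 has its six-vector in the cone** (the member's stray vertices removed). -/
theorem inCone_of_emb {k' : V'} (h : IsZc Z' k') (φ : ZoneEmb Z Z') {k : V} (hk : φ.v k = k') :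
    InCone (Z.sixVec k) := by
  haveI : Finite E' := Finite.of_injective φ.e.symm φ.e.symm.injective
  haveI : Finite T₁' := Finite.of_injective φ.t₁.symm φ.t₁.symm.injective
  haveI : Finite T₂' := Finite.of_injective φ.t₂.symm φ.t₂.symm.injective
  letI jE : Fintype E' := Fintype.ofFinite E'
  letI j₁ : Fintype T₁' := Fintype.ofFinite T₁'
  letI j₂ : Fintype T₂' := Fintype.ofFinite T₂'
  letI eE : DecidableEq E' := Classical.decEq E'
  letI e₁ : DecidableEq T₁' := Classical.decEq T₁'
  letI e₂ : DecidableEq T₂' := Classical.decEq T₂'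
  have h' : InCone (Z'.sixVec (φ.v k)) := by
    rw [hk]
    exact h.inCone jE eE j₁ e₁ j₂ e₂
  exact (φ.inCone_iff k).1 h'

/-- (P) on every zone embedded in a member of 𝒵. -/
theorem K4_of_emb {k' : V'} (h : IsZc Z' k') (φ : ZoneEmb Z Z') {k : V} (hk : φ.v k = k') :
    K4 (#(Z.Fset k) : ℝ) (#(Z.T1set k)) (#(Z.T2set k)) (#(Z.Iset k)) :=
  Z.K4_of_inCone_sixVec k (h.inCone_of_emb φ hk)

/-- The one-anchor (CS) on every zone embedded in a member of 𝒵. -/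
theorem zoneCSConj_of_emb {k' : V'} (h : IsZc Z' k') (φ : ZoneEmb Z Z') {k : V} (hk : φ.v k = k') :
    Z.ZoneCSConj {k} (∅ : Set V) :=
  Z.zoneCSConj_of_inCone_sixVec k (h.inCone_of_emb φ hk)

/-- The ZONE O-CUBE on every zone embedded in a member of 𝒵. -/
theorem zoneOCubeConj_of_emb {k' : V'} (h : IsZc Z' k') (φ : ZoneEmb Z Z') {k : V} (hk : φ.v k = k') :
    Z.ZoneOCubeConj {k} (∅ : Set V) :=
  Z.zoneOCubeConj_of_inCone_sixVec k (h.inCone_of_emb φ hk)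

end IsZc

/-! ## The one-vertex zone as a pendant of the marked point -/

namespace OneVertex

variable {V E T₁ T₂ : Type} (Z : ZoneData V E T₁ T₂) [Fintype T₁] [Fintype T₂]

/-- The marked point with as many marks as `Z`. -/
noncomputable abbrev point : ZoneData Unit Empty (Fin (Fintype.card T₁)) (Fin (Fintype.card T₂)) :=
  pointZone (Fintype.card T₁) (Fintype.card T₂)

/-- THE EMBEDDING of a one-vertex zone into the pendant of the marked point at `v₀` on `Z` itself (marks dropped):
vertices and edges to the left summand, marks to the point's marks. -/
noncomputable def oneVertexEmb (v₀ : V) (h1 : ∀ i, Z.at₁ i = v₀) (h2 : ∀ j, Z.at₂ j = v₀) :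
    ZoneEmb Z (pendant Z v₀ (point (T₁ := T₁) (T₂ := T₂)) ()) where
  v := Sum.inl
  inj := Sum.inl_injective
  e := (Equiv.sumEmpty E Empty).symm
  t₁ := Fintype.equivFin T₁
  t₂ := Fintype.equivFin T₂
  fst_map := fun _ => rfl
  snd_map := fun _ => rfl
  at₁_map := fun i => by
    show red v₀ () () = Sum.inl (Z.at₁ i)
    rw [red_self, h1 i]
  at₂_map := fun j => by
    show red v₀ () () = Sum.inl (Z.at₂ j)
    rw [red_self, h2 j]

/-- The vertex map of the embedding. -/
theorem oneVertexEmb_v (v₀ : V) (h1 : ∀ i, Z.at₁ i = v₀) (h2 : ∀ j, Z.at₂ j = v₀) (u : V) :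
    (oneVertexEmb Z v₀ h1 h2).v u = Sum.inl u := rfl

/-- The pendant of the marked point at `v₀` on `Z` is a member of 𝒵 at every anchor. -/
theorem isZc_pendant_point (v₀ k : V) : IsZc (pendant Z v₀ (point (T₁ := T₁) (T₂ := T₂)) ()) (Sum.inl k) :=
  IsZc.pendant Z v₀ k _ () (IsZc.point _ _)

section Cone

variable [Fintype E] [DecidableEq E] [DecidableEq T₁] [DecidableEq T₂]

/-- **THE ONE-MARKED-VERTEX SEED IN CONE FORM**: the six-vector of every zone whose marks all sit at one vertex lies
in the cone, at every anchor. -/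
theorem inCone_sixVec_oneVertex (v₀ : V) (h1 : ∀ i, Z.at₁ i = v₀) (h2 : ∀ j, Z.at₂ j = v₀) (k : V) :
    InCone (Z.sixVec k) :=
  (isZc_pendant_point Z v₀ k).inCone_of_emb (oneVertexEmb Z v₀ h1 h2) (oneVertexEmb_v Z v₀ h1 h2 k)

/-- (P) on a one-vertex zone, from the cone (mine-3's `oneVertex_cs` is the first proof). -/
theorem oneVertex_K4 (v₀ : V) (h1 : ∀ i, Z.at₁ i = v₀) (h2 : ∀ j, Z.at₂ j = v₀) (k : V) :
    K4 (#(Z.Fset k) : ℝ) (#(Z.T1set k)) (#(Z.T2set k)) (#(Z.Iset k)) :=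
  Z.K4_of_inCone_sixVec k (inCone_sixVec_oneVertex Z v₀ h1 h2 k)

/-- The one-anchor (CS) on a one-vertex zone, from the cone. -/
theorem oneVertex_zoneCSConj' (v₀ : V) (h1 : ∀ i, Z.at₁ i = v₀) (h2 : ∀ j, Z.at₂ j = v₀) (k : V) :
    Z.ZoneCSConj {k} (∅ : Set V) :=
  Z.zoneCSConj_of_inCone_sixVec k (inCone_sixVec_oneVertex Z v₀ h1 h2 k)

/-- The ZONE O-CUBE on a one-vertex zone, from the cone. -/
theorem oneVertex_zoneOCubeConj' (v₀ : V) (h1 : ∀ i, Z.at₁ i = v₀) (h2 : ∀ j, Z.at₂ j = v₀) (k : V) :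
    Z.ZoneOCubeConj {k} (∅ : Set V) :=
  Z.zoneOCubeConj_of_inCone_sixVec k (inCone_sixVec_oneVertex Z v₀ h1 h2 k)

/-- **A one-vertex zone hung at any vertex of any unmarked multigraph**: the six-vector of the pendant lies in the
cone (one-vertex zones are seeds of the six-vector form of 𝒵). -/
theorem inCone_sixVec_pendant_oneVertex (v₀ : V) (h1 : ∀ i, Z.at₁ i = v₀) (h2 : ∀ j, Z.at₂ j = v₀)
    {V₁ E₁ U₁ U₂ : Type} (Z₁ : ZoneData V₁ E₁ U₁ U₂) (u a : V₁) [Fintype E₁] [DecidableEq E₁] (a₂ : V) :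
    InCone ((pendant Z₁ u Z a₂).sixVec (Sum.inl a)) :=
  inCone_sixVec_pendant Z₁ u Z a₂ a (inCone_sixVec_oneVertex Z v₀ h1 h2 a₂)

end Cone

end OneVertex

end ZoneZ

end PercRepro
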